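import Mathlib.Analysis.InnerProductSpace.Calculus
import Mathlib.Analysis.Calculus.Deriv.Add
import Mathlib.Analysis.Calculus.Deriv.Mul
import Literature.MathematicalPhysics.KineticTheory.HardSphereEuler
import Literature.MathematicalPhysics.KineticTheory.LandauTellerEuler
import Literature.Analysis.FunctionSpaces.TorusCalculusProofs
import Literature.Analysis.FunctionSpaces.TorusTestFunction
import HarnessLib

/-!
# Loaded-sphere Euler and the two-temperature (translational/rotational) Euler system

Topic `Literature/MathematicalPhysics/KineticTheory` (definition items `defn-IsTwoTemperatureEulerSolution`,
`defn-IsLoadedEulerSolution`; requested by route `LoadedDice` of `AtomisticToContinuum/HydrodynamicLimit`,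
items `LoadedEulerRung`, `TwoTemperatureRung`, `TwoTemperaturePDE`). Companion of
`HardSphereEuler.lean`: the same torus calculus (`Torus.IsSmoothSpaceTimeOn`, `Torus.timeDerivWithin`,
`Torus.divergence`, `Torus.partialDeriv`, `Torus.gradient`), the same hard-sphere pressure law
`hsPressure σ ρ θ = ρ θ Z(ρσ³)`; only the caloric equation of state and the energy bookkeeping change.

## What is formalised

A **loaded sphere** (Jeans 1904; Dahler–Sather 1963; Davis 1973, §IX.C) is a smooth hard sphere whose
centre of mass is displaced from its geometric centre along a body-fixed symmetry axis. Contact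
geometry — hence excluded volume, free volume and the *thermal* equation of state — is exactly that of
hard spheres, `p = hsPressure σ ρ θ`; only the caloric equation of state changes: the axial spin is not
a dynamical variable (the impulsive torque is orthogonal to the axis), two rotational degrees of
freedom are active, and the heat capacity is the polyatomic `5/2` instead of `3/2`.

* `loadedEnergyDensity ρ u θ = ρ(|u|²/2 + 5θ/2)`; the rotational energy density of the two active
  degrees of freedom at rotational temperature `θrot` is `ρ θrot` (written inline), with
  `totalEnergyDensity ρ u θ + ρ θ = loadedEnergyDensity ρ u θ` (`totalEnergyDensity_add_rotEnergy`).
* `IsLoadedEulerSolution σ T ρ u θ` — `IsHardSphereEulerSolution` with `totalEnergyDensity` replaced by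
  `loadedEnergyDensity` in the energy balance (mass, momentum, smoothness, positivity and the pressure
  `hsPressure σ ρ θ` unchanged).
* `IsTwoTemperatureEulerSolution σ κ c T ρ u θtr θrot` — the **two-temperature Euler system**: the
  translational temperature `θtr` alone enters the pressure `p = hsPressure σ ρ θtr`; translational
  energy `E_tr = totalEnergyDensity ρ u θtr` and rotational energy `ρ θrot` are balanced separately and
  coupled by the stiff source `exchangeSource κ c ρ θtr θrot = κ² c(ρ, θtr, θrot) ρ (θtr − θrot)`:
  `∂ₜρ + div(ρu) = 0`, `∂ₜ(ρu) + ∑ᵢ ∂ᵢ(ρ uᵢ u) + ∇p = 0`,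
  `∂ₜE_tr + div((E_tr + p)u) = −κ² c ρ (θtr − θrot)`, `∂ₜ(ρθrot) + div(ρ θrot u) = +κ² c ρ (θtr − θrot)`.
  This is the closed 7-field system of Arima–Ruggeri–Sugiyama (§5.3: mass and momentum conservation
  with the translational pressure `p^K(ρ, θ^K)`, translational energy `2ρε^K + ρv²` with flux
  `(2ρε^K + ρv² + 2p^K)v` and BGK production `P^K`, rotational energy `2ρε^R` advected with production
  `P^R`) with the vibrational mode dropped, classical energies `ε^K = 3θ/2`, `ε^R = θ`, and the
  hard-sphere pressure law; a stiff relaxation system (Chen–Levermore–Liu) whose conserved quantities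
  are mass, momentum and total energy and whose equilibria are `θtr = θrot`. `c` is a parameter (for
  loaded spheres the Enskog translation–rotation exchange rate; `IsExchangeRate c` records smoothness
  and positivity on the physical octant), `κ` the eccentricity scale (only `κ²` enters).

## Sanity lemmas (all proved here)

* `κ = 0`: `(ρ, u, θtr)` is an `IsHardSphereEulerSolution` and `ρθrot` is passively advected, and
  conversely (`isHardSphereEulerSolution_of_kappa_eq_zero`, `rotEnergy_of_kappa_eq_zero`,
  `of_isHardSphereEulerSolution`, `isTwoTemperatureEulerSolution_zero_iff`).
* Total energy: the two energy balances sum to a source-free balance (`trEnergy_add_rotEnergy`,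
  unconditional) and, in merged form, `∂ₜ(E_tr + ρθrot) + div((E_tr + ρθrot + p)u) = 0` whenever the
  pressure field `x ↦ p(t, x)` is `C¹` (`totalEnergy`). The sum rules of the torus calculus hold for
  differentiable fields only, and `hsCompressibility` (a `limsup`/`deriv`) carries no regularity, so
  `C¹`-ness of the composite pressure field is an explicit hypothesis (automatic for a `C¹` equation of
  state).
* Equilibrium manifold: a two-temperature solution with `θtr = θrot` is an `IsLoadedEulerSolution`
  (`isLoadedEulerSolution_of_eq`, same proviso). The converse is false and not stated: a loaded Euler
  solution `(ρ, u, θ)` yields a two-temperature solution `(ρ, u, θ, θ)` only where `p div u = 0`, since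
  compression heats the translational mode alone (`(3/2)ρ Dₜθtr = −p div u`, `Dₜθrot = 0` on the
  manifold); the manifold is invariant only as `κ → ∞` (the lag is the bulk viscosity). Constant states
  with equal temperatures solve both systems for all `κ, c` (`isTwoTemperatureEulerSolution_const`,
  `isLoadedEulerSolution_const`; non-vacuity).

## Design choices

* Exact shape of `IsHardSphereEulerSolution` (conservative variables, one-sided time derivative within
  `Ico 0 T`, pointwise equations, `ρ, θ > 0`), so that `κ = 0` is *literally* the hard-sphere system.
* `κ`, `c`, `σ` are bare parameters of the solution notion (as `σ` is in `IsHardSphereEulerSolution`);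
  sign / positivity / smoothness requirements on them belong to the statements that quantify over them
  (`IsExchangeRate c`, `0 ≤ κ`), not to the notion of solution.
* Nothing hard-sphere is duplicated: `T3`, `V3`, `hsPressure`, `totalEnergyDensity` are those of
  `HardSphereEuler.lean`; the Leibniz rules of the torus calculus are those proved in
  `LandauTellerEuler.lean`.
* Relation to `IsLandauTellerEulerSolution σ r c T ρ u θtr θrot` (`LandauTellerEuler.lean`, the
  ROUGH-sphere two-temperature system of route `RoughSpheresKappaDial`): same shape and conventions,
  but rough spheres have THREE active rotational degrees of freedom (`rotationalEnergyDensity ρ θ =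
  (3/2)ρθ`, exchange `(3/2)ρ ν (θtr − θrot)`, equilibrium `γ = 4/3`), loaded spheres TWO (`ρθ`,
  exchange `κ² c ρ (θtr − θrot)`, equilibrium `γ = 7/5`), and the coupling is scaled by the squared
  eccentricity `κ²` rather than by a window parameter `r`; the rotational temperature fields of the two
  notions are therefore not interchangeable and neither structure is a special case of the other.

## References

* H. T. Davis, *Kinetic theory of dense fluids and liquids revisited*, Adv. Chem. Phys. 24 (1973)
  257–343, §IX.C "Loaded sphere fluids" (the model: hard sphere with displaced mass centre on a symmetry
  axis, state `(x, v, e, ω = e × ė)`; hard-sphere Enskog statics; `C̃_v = (5/2)k` for loaded spheres).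
* S. Chapman, T. G. Cowling, *The Mathematical Theory of Non-uniform Gases*, 3rd ed. (1970), §11.1
  (rough spheres; the loaded sphere as the next simplest rotating model; Jeans 1904).
* J. S. Dahler, N. F. Sather, *Kinetic theory of loaded spheres. I*, J. Chem. Phys. 38 (1963) 2363–2382;
  S. I. Sandler, J. S. Dahler, *Kinetic theory of loaded spheres. II*, J. Chem. Phys. 43 (1965)
  1750–1759 (primary sources; translation–rotation exchange at Boltzmann/Enskog level).
* T. Arima, T. Ruggeri, M. Sugiyama, *Rational extended thermodynamics of a rarefied polyatomic gas with
  molecular relaxation processes*, Phys. Rev. E 96 (2017) 042143 = arXiv:1708.06231 (section numbers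
  below are those of the arXiv version: §5.3 closed 7-field system, §5.5 BGK production terms,
  §6.2 sub-characteristic condition, §6.3 the 6-field subsystems with total-energy conservation).
* G.-Q. Chen, C. D. Levermore, T.-P. Liu, *Hyperbolic conservation laws with stiff relaxation terms and
  entropy*, Comm. Pure Appl. Math. 47 (1994) 787–830; T.-P. Liu in LNM 1640 (1996), §5 (relaxation
  systems, equilibrium equations, sub-characteristic condition).
* H. Spohn, *Large Scale Dynamics of Interacting Particles* (1991), Part I, Ch. 3.
-/

noncomputable section

open Set
open scoped ContDiff
open Literature.Analysis.FunctionSpaces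

namespace Literature.MathematicalPhysics.KineticTheory

/-! ### Caloric equation of state of loaded spheres; exchange source -/

/-- Total energy density `E = ρ(|u|²/2 + 5θ/2)` of a gas of loaded spheres with isotropic
(or axisymmetric) inertia: kinetic energy of the mean flow plus `(3/2)θ` translational plus
`(2/2)θ` for the two *active* rotational degrees of freedom (the axial spin is conserved by the
frictionless impulsive dynamics and is a passive label) — the caloric equation of state of a rigid
diatomic gas, `γ = 7/5`; Davis: "the polyatomic value `C̃_v = (5/2)k` appropriate to loaded spheres".
[cite: Davis1973, §IX.C] -/
def loadedEnergyDensity (ρ : ℝ) (u : V3) (θ : ℝ) : ℝ :=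
  ρ * (‖u‖ ^ 2 / 2 + 5 / 2 * θ)

/-- The stiff translation–rotation **exchange source** `κ² c(ρ, θtr, θrot) ρ (θtr − θrot)`: energy
per unit volume and time flowing from the translational into the rotational mode; `c` is the
exchange-rate function (arguments `ρ, θtr, θrot`), `κ` the relaxation scale (only `κ²` enters).
This is (one half of) the BGK-type production term `P^K_ll = -(2ρ/τ_KR)(ε^K_E(θ^K) - ε^K_E(θ^KR))` of
Arima–Ruggeri–Sugiyama, which for classical modes (`ε^K = 3θ/2`, `ε^R = θ`) equals
`-(3/(5τ_KR)) ρ (θ^K - θ^R)`, i.e. `κ² c = 3/(5 τ_KR)`. [cite: ArimaRuggeriSugiyama2017, §5.5] -/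
def exchangeSource (κ : ℝ) (c : ℝ → ℝ → ℝ → ℝ) (ρ θtr θrot : ℝ) : ℝ :=
  κ ^ 2 * c ρ θtr θrot * ρ * (θtr - θrot)

/-- An admissible **exchange-rate function** `c(ρ, θtr, θrot)`: jointly smooth and strictly positive
on the physical octant `ρ > 0, θtr > 0, θrot > 0` (positive relaxation times `τ > 0`; for loaded
spheres `c` is the Enskog translation–rotation exchange rate, proportional to the contact value of the
pair correlation and to the thermal speed). [cite: ArimaRuggeriSugiyama2017, §5.5] -/
def IsExchangeRate (c : ℝ → ℝ → ℝ → ℝ) : Prop :=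
  ContDiffOn ℝ ∞ (fun q : ℝ × ℝ × ℝ => c q.1 q.2.1 q.2.2) {q | 0 < q.1 ∧ 0 < q.2.1 ∧ 0 < q.2.2} ∧
    ∀ ρ θtr θrot : ℝ, 0 < ρ → 0 < θtr → 0 < θrot → 0 < c ρ θtr θrot

/-- Unfolding `loadedEnergyDensity`. [cite: Davis1973, §IX.C] -/
theorem loadedEnergyDensity_def (ρ : ℝ) (u : V3) (θ : ℝ) :
    loadedEnergyDensity ρ u θ = ρ * (‖u‖ ^ 2 / 2 + 5 / 2 * θ) :=
  rfl

/-- Unfolding `exchangeSource`. [cite: ArimaRuggeriSugiyama2017, §5.5] -/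
theorem exchangeSource_def (κ : ℝ) (c : ℝ → ℝ → ℝ → ℝ) (ρ θtr θrot : ℝ) :
    exchangeSource κ c ρ θtr θrot = κ ^ 2 * c ρ θtr θrot * ρ * (θtr - θrot) :=
  rfl

/-- Energy bookkeeping: translational-plus-kinetic energy at temperature `θ` plus the rotational
energy `ρθ` (two active rotational degrees of freedom) at the *same* temperature is the loaded-sphere
total energy, `ρ(|u|²/2 + 3θ/2) + ρθ = ρ(|u|²/2 + 5θ/2)`. [cite: Davis1973, §IX.C] -/
theorem totalEnergyDensity_add_rotEnergy (ρ : ℝ) (u : V3) (θ : ℝ) :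
    totalEnergyDensity ρ u θ + ρ * θ = loadedEnergyDensity ρ u θ := by
  simp only [totalEnergyDensity, loadedEnergyDensity]
  ring

/-- A constant exchange rate `c₀ > 0` is admissible (BGK relaxation with constant relaxation time).
[cite: ArimaRuggeriSugiyama2017, §5.5] -/
theorem isExchangeRate_const {c₀ : ℝ} (hc₀ : 0 < c₀) : IsExchangeRate fun _ _ _ => c₀ :=
  ⟨contDiffOn_const, fun _ _ _ _ _ _ => hc₀⟩

/-- The exchange source switches off at `κ = 0`. [cite: ArimaRuggeriSugiyama2017, §5.5] -/
@[simp]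
theorem exchangeSource_zero (c : ℝ → ℝ → ℝ → ℝ) (ρ θtr θrot : ℝ) :
    exchangeSource 0 c ρ θtr θrot = 0 := by
  simp [exchangeSource]

/-- The exchange source vanishes on the local-equilibrium manifold `θtr = θrot`.
[cite: ArimaRuggeriSugiyama2017, §5.5] -/
@[simp]
theorem exchangeSource_self (κ : ℝ) (c : ℝ → ℝ → ℝ → ℝ) (ρ θ : ℝ) :
    exchangeSource κ c ρ θ θ = 0 := by
  simp [exchangeSource]

/-- Sign of the exchange: for `κ ≠ 0`, `c > 0` and `ρ > 0` the source is non-negative iff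
`θrot ≤ θtr` (energy flows from the hotter mode to the colder one). [cite: ArimaRuggeriSugiyama2017, §5.5] -/
theorem exchangeSource_nonneg_iff {κ : ℝ} (hκ : κ ≠ 0) {c : ℝ → ℝ → ℝ → ℝ} {ρ θtr θrot : ℝ}
    (hc : 0 < c ρ θtr θrot) (hρ : 0 < ρ) :
    0 ≤ exchangeSource κ c ρ θtr θrot ↔ θrot ≤ θtr := by
  have h : 0 < κ ^ 2 * c ρ θtr θrot * ρ := by positivity
  rw [exchangeSource, mul_nonneg_iff_of_pos_left h, sub_nonneg]

/-! ### Classical solutions of the loaded-sphere Euler system on `𝕋³` -/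

/-- **Classical solution of the compressible Euler equations of the loaded-sphere gas** on
`[0, T) × 𝕋³`: the clauses of `IsHardSphereEulerSolution σ T ρ u θ` (jointly smooth `ρ, u, θ` on
`[0,T) × 𝕋³`, `ρ, θ > 0`, `∂ₜρ + div(ρu) = 0`, `∂ₜ(ρu) + ∑ᵢ ∂ᵢ(ρ uᵢ u) + ∇p = 0` with the
hard-sphere pressure `p = hsPressure σ ρ θ` — loaded spheres have the hard-sphere statics), except
that the energy balance `∂ₜE + div((E + p)u) = 0` is written for the loaded-sphere energy
`E = loadedEnergyDensity ρ u θ = ρ(|u|²/2 + 5θ/2)`. [cite: Davis1973, §IX.C] -/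
structure IsLoadedEulerSolution (σ T : ℝ) (ρ : ℝ → T3 → ℝ) (u : ℝ → T3 → V3)
    (θ : ℝ → T3 → ℝ) : Prop where
  smooth_density : Torus.IsSmoothSpaceTimeOn (Ico 0 T) ρ
  smooth_velocity : Torus.IsSmoothSpaceTimeOn (Ico 0 T) u
  smooth_temperature : Torus.IsSmoothSpaceTimeOn (Ico 0 T) θ
  density_pos : ∀ t ∈ Ico 0 T, ∀ x, 0 < ρ t x
  temperature_pos : ∀ t ∈ Ico 0 T, ∀ x, 0 < θ t x
  mass : ∀ t ∈ Ico 0 T, ∀ x,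
    Torus.timeDerivWithin (Ico 0 T) ρ t x + Torus.divergence (fun y => ρ t y • u t y) x = 0
  momentum : ∀ t ∈ Ico 0 T, ∀ x,
    Torus.timeDerivWithin (Ico 0 T) (fun s y => ρ s y • u s y) t x +
      (∑ i, Torus.partialDeriv i (fun y => (ρ t y * u t y i) • u t y) x) +
      Torus.gradient (fun y => hsPressure σ (ρ t y) (θ t y)) x = 0
  energy : ∀ t ∈ Ico 0 T, ∀ x,
    Torus.timeDerivWithin (Ico 0 T) (fun s y => loadedEnergyDensity (ρ s y) (u s y) (θ s y)) t x +
      Torus.divergence (fun y =>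
        (loadedEnergyDensity (ρ t y) (u t y) (θ t y) + hsPressure σ (ρ t y) (θ t y)) • u t y) x = 0

/-! ### Classical solutions of the two-temperature Euler system on `𝕋³` -/

/-- **Classical solution of the two-temperature (translational/rotational) Euler system of the
loaded-sphere gas** on `[0, T) × 𝕋³`, with eccentricity scale `κ`, exchange-rate function
`c(ρ, θtr, θrot)` and reduced diameter `σ`: `ρ, u, θtr, θrot` jointly smooth on `[0,T) × 𝕋³`,
`ρ, θtr, θrot > 0`, and pointwise on `[0,T) × 𝕋³` (one-sided time derivative within `[0,T)`)
* mass `∂ₜρ + div(ρu) = 0`;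
* momentum `∂ₜ(ρu) + ∑ᵢ ∂ᵢ(ρ uᵢ u) + ∇p = 0` with `p = hsPressure σ ρ θtr` (only the translational
  temperature enters the pressure);
* translational energy `∂ₜE_tr + div((E_tr + p)u) = −κ² c ρ (θtr − θrot)`,
  `E_tr = totalEnergyDensity ρ u θtr = ρ(|u|²/2 + 3θtr/2)`;
* rotational energy `∂ₜ(ρθrot) + div(ρ θrot u) = +κ² c ρ (θtr − θrot)` (energy `θrot` per particle
  for the two active rotational degrees of freedom; source `exchangeSource κ c ρ θtr θrot`).
This is the 6-field `(ρ, u, θtr, θrot)` system obtained from the closed 7-field system of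
Arima–Ruggeri–Sugiyama (mass; momentum with the translational pressure `p^K(ρ, θ^K)`;
translational energy `2ρε^K + ρv²` with flux `(2ρε^K + ρv² + 2p^K)v` and production `P^K`;
rotational energy `2ρε^R` advected with production `P^R`) by dropping the vibrational mode, with
classical energies `ε^K = 3θ^K/2`, `ε^R = θ^R`, BGK production `∓κ² c ρ (θtr − θrot)` and the
hard-sphere pressure law in place of the ideal-gas one: a stiff relaxation system whose equilibria
`θtr = θrot` carry `IsLoadedEulerSolution` and whose `κ = 0` member is `IsHardSphereEulerSolution`
for `(ρ, u, θtr)` with `ρθrot` passively advected. [cite: ArimaRuggeriSugiyama2017, §5.3] -/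
structure IsTwoTemperatureEulerSolution (σ κ : ℝ) (c : ℝ → ℝ → ℝ → ℝ) (T : ℝ) (ρ : ℝ → T3 → ℝ)
    (u : ℝ → T3 → V3) (θtr θrot : ℝ → T3 → ℝ) : Prop where
  smooth_density : Torus.IsSmoothSpaceTimeOn (Ico 0 T) ρ
  smooth_velocity : Torus.IsSmoothSpaceTimeOn (Ico 0 T) u
  smooth_trTemperature : Torus.IsSmoothSpaceTimeOn (Ico 0 T) θtr
  smooth_rotTemperature : Torus.IsSmoothSpaceTimeOn (Ico 0 T) θrot
  density_pos : ∀ t ∈ Ico 0 T, ∀ x, 0 < ρ t x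
  trTemperature_pos : ∀ t ∈ Ico 0 T, ∀ x, 0 < θtr t x
  rotTemperature_pos : ∀ t ∈ Ico 0 T, ∀ x, 0 < θrot t x
  mass : ∀ t ∈ Ico 0 T, ∀ x,
    Torus.timeDerivWithin (Ico 0 T) ρ t x + Torus.divergence (fun y => ρ t y • u t y) x = 0
  momentum : ∀ t ∈ Ico 0 T, ∀ x,
    Torus.timeDerivWithin (Ico 0 T) (fun s y => ρ s y • u s y) t x +
      (∑ i, Torus.partialDeriv i (fun y => (ρ t y * u t y i) • u t y) x) +
      Torus.gradient (fun y => hsPressure σ (ρ t y) (θtr t y)) x = 0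
  trEnergy : ∀ t ∈ Ico 0 T, ∀ x,
    Torus.timeDerivWithin (Ico 0 T) (fun s y => totalEnergyDensity (ρ s y) (u s y) (θtr s y)) t x +
      Torus.divergence (fun y =>
        (totalEnergyDensity (ρ t y) (u t y) (θtr t y) + hsPressure σ (ρ t y) (θtr t y)) • u t y) x =
      -exchangeSource κ c (ρ t x) (θtr t x) (θrot t x)
  rotEnergy : ∀ t ∈ Ico 0 T, ∀ x,
    Torus.timeDerivWithin (Ico 0 T) (fun s y => ρ s y * θrot s y) t x +
      Torus.divergence (fun y => (ρ t y * θrot t y) • u t y) x =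
      exchangeSource κ c (ρ t x) (θtr t x) (θrot t x)

/-! ### `κ = 0`: the hard-sphere Euler system with a passively advected rotational temperature -/

namespace IsTwoTemperatureEulerSolution

variable {σ κ : ℝ} {c : ℝ → ℝ → ℝ → ℝ} {T : ℝ} {ρ : ℝ → T3 → ℝ} {u : ℝ → T3 → V3}
  {θtr θrot : ℝ → T3 → ℝ}

/-- At `κ = 0` the translational fields `(ρ, u, θtr)` of a two-temperature solution form a
classical hard-sphere Euler solution (the exchange source is switched off).
[cite: ArimaRuggeriSugiyama2017, §5.3] -/
theorem isHardSphereEulerSolution_of_kappa_eq_zero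
    (h : IsTwoTemperatureEulerSolution σ 0 c T ρ u θtr θrot) :
    IsHardSphereEulerSolution σ T ρ u θtr where
  smooth_density := h.smooth_density
  smooth_velocity := h.smooth_velocity
  smooth_temperature := h.smooth_trTemperature
  density_pos := h.density_pos
  temperature_pos := h.trTemperature_pos
  mass := h.mass
  momentum := h.momentum
  energy t ht x := by simpa using h.trEnergy t ht x

/-- At `κ = 0` the rotational energy `ρθrot` is passively advected:
`∂ₜ(ρθrot) + div(ρ θrot u) = 0`. [cite: ArimaRuggeriSugiyama2017, §5.3] -/
theorem rotEnergy_of_kappa_eq_zero (h : IsTwoTemperatureEulerSolution σ 0 c T ρ u θtr θrot)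
    {t : ℝ} (ht : t ∈ Ico 0 T) (x : T3) :
    Torus.timeDerivWithin (Ico 0 T) (fun s y => ρ s y * θrot s y) t x +
      Torus.divergence (fun y => (ρ t y * θrot t y) • u t y) x = 0 := by
  simpa using h.rotEnergy t ht x

/-- Conversely, a hard-sphere Euler solution `(ρ, u, θtr)` together with a smooth positive
rotational temperature whose energy `ρθrot` is passively advected is a two-temperature solution
at `κ = 0`, for every exchange-rate function. [cite: ArimaRuggeriSugiyama2017, §5.3] -/
theorem of_isHardSphereEulerSolution (h : IsHardSphereEulerSolution σ T ρ u θtr)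
    (hsmooth : Torus.IsSmoothSpaceTimeOn (Ico 0 T) θrot) (hpos : ∀ t ∈ Ico 0 T, ∀ x, 0 < θrot t x)
    (hadv : ∀ t ∈ Ico 0 T, ∀ x,
      Torus.timeDerivWithin (Ico 0 T) (fun s y => ρ s y * θrot s y) t x +
        Torus.divergence (fun y => (ρ t y * θrot t y) • u t y) x = 0) :
    IsTwoTemperatureEulerSolution σ 0 c T ρ u θtr θrot where
  smooth_density := h.smooth_density
  smooth_velocity := h.smooth_velocity
  smooth_trTemperature := h.smooth_temperature
  smooth_rotTemperature := hsmooth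
  density_pos := h.density_pos
  trTemperature_pos := h.temperature_pos
  rotTemperature_pos := hpos
  mass := h.mass
  momentum := h.momentum
  trEnergy t ht x := by simpa using h.energy t ht x
  rotEnergy t ht x := by simpa using hadv t ht x

end IsTwoTemperatureEulerSolution

/-- `κ = 0` characterisation: two-temperature solutions at `κ = 0` are exactly hard-sphere Euler
solutions `(ρ, u, θtr)` carrying a smooth, positive, passively advected rotational temperature.
[cite: ArimaRuggeriSugiyama2017, §5.3] -/
theorem isTwoTemperatureEulerSolution_zero_iff {σ : ℝ} {c : ℝ → ℝ → ℝ → ℝ} {T : ℝ}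
    {ρ : ℝ → T3 → ℝ} {u : ℝ → T3 → V3} {θtr θrot : ℝ → T3 → ℝ} :
    IsTwoTemperatureEulerSolution σ 0 c T ρ u θtr θrot ↔
      IsHardSphereEulerSolution σ T ρ u θtr ∧ Torus.IsSmoothSpaceTimeOn (Ico 0 T) θrot ∧
        (∀ t ∈ Ico 0 T, ∀ x, 0 < θrot t x) ∧
        ∀ t ∈ Ico 0 T, ∀ x,
          Torus.timeDerivWithin (Ico 0 T) (fun s y => ρ s y * θrot s y) t x +
            Torus.divergence (fun y => (ρ t y * θrot t y) • u t y) x = 0 :=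
  ⟨fun h => ⟨h.isHardSphereEulerSolution_of_kappa_eq_zero, h.smooth_rotTemperature,
      h.rotTemperature_pos, fun _ ht x => h.rotEnergy_of_kappa_eq_zero ht x⟩,
    fun h => IsTwoTemperatureEulerSolution.of_isHardSphereEulerSolution h.1 h.2.1 h.2.2.1 h.2.2.2⟩

/-! ### Conservation of total energy; the equilibrium manifold -/

namespace IsTwoTemperatureEulerSolution

variable {σ κ : ℝ} {c : ℝ → ℝ → ℝ → ℝ} {T : ℝ} {ρ : ℝ → T3 → ℝ} {u : ℝ → T3 → V3}
  {θtr θrot : ℝ → T3 → ℝ}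

/-- The two energy balances have opposite sources: their sum is source-free (no regularity
needed; total energy is a conserved quantity of the relaxation system).
[cite: ArimaRuggeriSugiyama2017, §6.3] -/
theorem trEnergy_add_rotEnergy (h : IsTwoTemperatureEulerSolution σ κ c T ρ u θtr θrot) {t : ℝ}
    (ht : t ∈ Ico 0 T) (x : T3) :
    Torus.timeDerivWithin (Ico 0 T) (fun s y => totalEnergyDensity (ρ s y) (u s y) (θtr s y)) t x +
      Torus.timeDerivWithin (Ico 0 T) (fun s y => ρ s y * θrot s y) t x +
      (Torus.divergence (fun y =>
          (totalEnergyDensity (ρ t y) (u t y) (θtr t y) + hsPressure σ (ρ t y) (θtr t y)) • u t y) x +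
        Torus.divergence (fun y => (ρ t y * θrot t y) • u t y) x) = 0 := by
  have h1 := h.trEnergy t ht x
  have h2 := h.rotEnergy t ht x
  linarith

/-- Time slices of the translational energy density are differentiable in time within `[0,T)`.
[folklore] -/
theorem differentiableWithinAt_trEnergy (h : IsTwoTemperatureEulerSolution σ κ c T ρ u θtr θrot)
    {t : ℝ} (ht : t ∈ Ico 0 T) (x : T3) :
    DifferentiableWithinAt ℝ (fun s => totalEnergyDensity (ρ s x) (u s x) (θtr s x)) (Ico 0 T) t := by
  have hρ : DifferentiableWithinAt ℝ (fun s => ρ s x) (Ico 0 T) t :=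
    (h.smooth_density.hasDerivWithinAt_slice ht x).differentiableWithinAt
  have hu : DifferentiableWithinAt ℝ (fun s => u s x) (Ico 0 T) t :=
    (h.smooth_velocity.hasDerivWithinAt_slice ht x).differentiableWithinAt
  have hθ : DifferentiableWithinAt ℝ (fun s => θtr s x) (Ico 0 T) t :=
    (h.smooth_trTemperature.hasDerivWithinAt_slice ht x).differentiableWithinAt
  unfold totalEnergyDensity
  exact hρ.mul (((hu.norm_sq ℝ).div_const 2).add (hθ.const_mul _))

/-- Time slices of the rotational energy density `ρ θrot` are differentiable in time within
`[0,T)`. [folklore] -/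
theorem differentiableWithinAt_rotEnergy (h : IsTwoTemperatureEulerSolution σ κ c T ρ u θtr θrot)
    {t : ℝ} (ht : t ∈ Ico 0 T) (x : T3) :
    DifferentiableWithinAt ℝ (fun s => ρ s x * θrot s x) (Ico 0 T) t :=
  (h.smooth_density.hasDerivWithinAt_slice ht x).differentiableWithinAt.mul
    (h.smooth_rotTemperature.hasDerivWithinAt_slice ht x).differentiableWithinAt

/-- Spatial slices of the translational energy density are `C¹` on the torus. [folklore] -/
theorem isContDiff_trEnergy (h : IsTwoTemperatureEulerSolution σ κ c T ρ u θtr θrot) {t : ℝ}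
    (ht : t ∈ Ico 0 T) :
    Torus.IsContDiff 1 (fun y => totalEnergyDensity (ρ t y) (u t y) (θtr t y)) := by
  have hρ : Torus.IsContDiff 1 (ρ t) := (h.smooth_density.isSmooth_slice ht).isContDiff (by simp)
  have hu : Torus.IsContDiff 1 (u t) := (h.smooth_velocity.isSmooth_slice ht).isContDiff (by simp)
  have hθ : Torus.IsContDiff 1 (θtr t) :=
    (h.smooth_trTemperature.isSmooth_slice ht).isContDiff (by simp)
  exact hρ.mul (((hu.norm_sq ℝ).div_const 2).add (contDiff_const.mul hθ))

/-- Spatial slices of the rotational energy density `ρ θrot` are `C¹` on the torus. [folklore] -/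
theorem isContDiff_rotEnergy (h : IsTwoTemperatureEulerSolution σ κ c T ρ u θtr θrot) {t : ℝ}
    (ht : t ∈ Ico 0 T) : Torus.IsContDiff 1 (fun y => ρ t y * θrot t y) :=
  ContDiff.mul ((h.smooth_density.isSmooth_slice ht).isContDiff (by simp))
    ((h.smooth_rotTemperature.isSmooth_slice ht).isContDiff (by simp))

/-- **Conservation of total energy.** If the pressure field `x ↦ p(t, x)` is `C¹` on the torus
(true whenever the equation of state is `C¹` on the range of `(ρ, θtr)`), the total energy
`E_tr + ρθrot` of a two-temperature solution satisfies the local conservation law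
`∂ₜ(E_tr + ρθrot) + div((E_tr + ρθrot + p)u) = 0`: the relaxation source conserves mass, momentum
and total energy (the third conservation law of the 6-field subsystem). Leibniz rules of the torus
calculus from `LandauTellerEuler.lean`. [cite: ArimaRuggeriSugiyama2017, §6.3] -/
theorem totalEnergy (h : IsTwoTemperatureEulerSolution σ κ c T ρ u θtr θrot) {t : ℝ}
    (ht : t ∈ Ico 0 T) (hp : Torus.IsContDiff 1 (fun y => hsPressure σ (ρ t y) (θtr t y))) (x : T3) :
    Torus.timeDerivWithin (Ico 0 T) (fun s y =>
        totalEnergyDensity (ρ s y) (u s y) (θtr s y) + ρ s y * θrot s y) t x +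
      Torus.divergence (fun y =>
        (totalEnergyDensity (ρ t y) (u t y) (θtr t y) + ρ t y * θrot t y +
          hsPressure σ (ρ t y) (θtr t y)) • u t y) x = 0 := by
  have htime : Torus.timeDerivWithin (Ico 0 T) (fun s y =>
        totalEnergyDensity (ρ s y) (u s y) (θtr s y) + ρ s y * θrot s y) t x =
      Torus.timeDerivWithin (Ico 0 T) (fun s y => totalEnergyDensity (ρ s y) (u s y) (θtr s y)) t x +
        Torus.timeDerivWithin (Ico 0 T) (fun s y => ρ s y * θrot s y) t x :=
    derivWithin_fun_add (h.differentiableWithinAt_trEnergy ht x) (h.differentiableWithinAt_rotEnergy ht x)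
  have hu1 : Torus.IsContDiff 1 (u t) := (h.smooth_velocity.isSmooth_slice ht).isContDiff (by simp)
  have hEtr1 := h.isContDiff_trEnergy ht
  have hErot1 := h.isContDiff_rotEnergy ht
  have hEp1 : Torus.IsContDiff 1 (fun y => totalEnergyDensity (ρ t y) (u t y) (θtr t y) +
      hsPressure σ (ρ t y) (θtr t y)) := hEtr1.add hp
  have hEE1 : Torus.IsContDiff 1 (fun y => totalEnergyDensity (ρ t y) (u t y) (θtr t y) +
      ρ t y * θrot t y) := hEtr1.add hErot1
  have hsum1 : Torus.IsContDiff 1 (fun y => totalEnergyDensity (ρ t y) (u t y) (θtr t y) +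
      ρ t y * θrot t y + hsPressure σ (ρ t y) (θtr t y)) := hEE1.add hp
  have hdiv : Torus.divergence (fun y =>
        (totalEnergyDensity (ρ t y) (u t y) (θtr t y) + ρ t y * θrot t y +
          hsPressure σ (ρ t y) (θtr t y)) • u t y) x =
      Torus.divergence (fun y =>
          (totalEnergyDensity (ρ t y) (u t y) (θtr t y) + hsPressure σ (ρ t y) (θtr t y)) • u t y) x +
        Torus.divergence (fun y => (ρ t y * θrot t y) • u t y) x := by
    rw [IsLandauTellerEulerSolution.torusDivergence_smul_apply hsum1 hu1,
      IsLandauTellerEulerSolution.torusDivergence_smul_apply hEp1 hu1,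
      IsLandauTellerEulerSolution.torusDivergence_smul_apply hErot1 hu1,
      IsLandauTellerEulerSolution.torusFDeriv_add_apply hEE1 hp,
      IsLandauTellerEulerSolution.torusFDeriv_add_apply hEtr1 hErot1,
      IsLandauTellerEulerSolution.torusFDeriv_add_apply hEtr1 hp]
    ring
  rw [htime, hdiv]
  linarith [h.trEnergy_add_rotEnergy ht x]

/-- **The equilibrium manifold carries the loaded Euler system.** A two-temperature solution whose
two temperatures coincide on `[0, T) × 𝕋³` is a classical loaded-sphere Euler solution for
`(ρ, u, θtr)` (total energy `E_tr + ρθ = ρ(|u|²/2 + 5θ/2)`), provided the pressure field is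
spatially `C¹` at each time (as in `totalEnergy`): the equilibrium subsystem with the common
temperature. [cite: ArimaRuggeriSugiyama2017, §6.3] -/
theorem isLoadedEulerSolution_of_eq (h : IsTwoTemperatureEulerSolution σ κ c T ρ u θtr θrot)
    (heq : ∀ t ∈ Ico 0 T, ∀ x, θrot t x = θtr t x)
    (hp : ∀ t ∈ Ico 0 T, Torus.IsContDiff 1 (fun y => hsPressure σ (ρ t y) (θtr t y))) :
    IsLoadedEulerSolution σ T ρ u θtr where
  smooth_density := h.smooth_density
  smooth_velocity := h.smooth_velocity
  smooth_temperature := h.smooth_trTemperature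
  density_pos := h.density_pos
  temperature_pos := h.trTemperature_pos
  mass := h.mass
  momentum := h.momentum
  energy t ht x := by
    have h' := h.totalEnergy ht (hp t ht) x
    have h1 : Torus.timeDerivWithin (Ico 0 T) (fun s y =>
        totalEnergyDensity (ρ s y) (u s y) (θtr s y) + ρ s y * θrot s y) t x =
        Torus.timeDerivWithin (Ico 0 T)
          (fun s y => loadedEnergyDensity (ρ s y) (u s y) (θtr s y)) t x := by
      unfold Torus.timeDerivWithin
      refine derivWithin_congr (fun s hs => ?_) ?_
      · simp only [heq s hs x, totalEnergyDensity_add_rotEnergy]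
      · simp only [heq t ht x, totalEnergyDensity_add_rotEnergy]
    have h2 : (fun y => (totalEnergyDensity (ρ t y) (u t y) (θtr t y) + ρ t y * θrot t y +
        hsPressure σ (ρ t y) (θtr t y)) • u t y) =
        fun y => (loadedEnergyDensity (ρ t y) (u t y) (θtr t y) + hsPressure σ (ρ t y) (θtr t y)) •
          u t y := by
      funext y
      rw [heq t ht y, totalEnergyDensity_add_rotEnergy]
    rw [h1, h2] at h'
    exact h'

end IsTwoTemperatureEulerSolution

/-! ### Constant states (non-vacuity) -/

/-- **Constant states** `ρ ≡ ρ₀ > 0`, `u ≡ u₀`, `θ ≡ θ₀ > 0` solve the loaded Euler system on every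
`[0, T)` (all derivatives vanish; non-vacuity of `IsLoadedEulerSolution`). [folklore] -/
theorem isLoadedEulerSolution_const (σ T : ℝ) {ρ₀ θ₀ : ℝ} (hρ₀ : 0 < ρ₀) (hθ₀ : 0 < θ₀) (u₀ : V3) :
    IsLoadedEulerSolution σ T (fun _ _ => ρ₀) (fun _ _ => u₀) (fun _ _ => θ₀) where
  smooth_density := contDiffOn_const
  smooth_velocity := contDiffOn_const
  smooth_temperature := contDiffOn_const
  density_pos _ _ _ := hρ₀
  temperature_pos _ _ _ := hθ₀
  mass t _ x := by simp [Torus.timeDerivWithin, Torus.divergence, Torus.partialDeriv, Torus.lineDeriv]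
  momentum t _ x := by
    simp [Torus.timeDerivWithin, Torus.partialDeriv, Torus.lineDeriv,
      IsLandauTellerEulerSolution.torusGradient_const_apply]
  energy t _ x := by
    simp [Torus.timeDerivWithin, Torus.divergence, Torus.partialDeriv, Torus.lineDeriv]

/-- **Constant equilibrium states** `ρ ≡ ρ₀ > 0`, `u ≡ u₀`, `θtr ≡ θrot ≡ θ₀ > 0` solve the
two-temperature system for every `σ, κ, c, T` (the source vanishes on the equilibrium manifold and
all derivatives vanish; non-vacuity of `IsTwoTemperatureEulerSolution`). Constant states with
`θtr ≠ θrot` are NOT solutions unless `κ² c = 0`. [folklore] -/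
theorem isTwoTemperatureEulerSolution_const (σ κ : ℝ) (c : ℝ → ℝ → ℝ → ℝ) (T : ℝ) {ρ₀ θ₀ : ℝ}
    (hρ₀ : 0 < ρ₀) (hθ₀ : 0 < θ₀) (u₀ : V3) :
    IsTwoTemperatureEulerSolution σ κ c T (fun _ _ => ρ₀) (fun _ _ => u₀) (fun _ _ => θ₀)
      (fun _ _ => θ₀) where
  smooth_density := contDiffOn_const
  smooth_velocity := contDiffOn_const
  smooth_trTemperature := contDiffOn_const
  smooth_rotTemperature := contDiffOn_const
  density_pos _ _ _ := hρ₀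
  trTemperature_pos _ _ _ := hθ₀
  rotTemperature_pos _ _ _ := hθ₀
  mass t _ x := by simp [Torus.timeDerivWithin, Torus.divergence, Torus.partialDeriv, Torus.lineDeriv]
  momentum t _ x := by
    simp [Torus.timeDerivWithin, Torus.partialDeriv, Torus.lineDeriv,
      IsLandauTellerEulerSolution.torusGradient_const_apply]
  trEnergy t _ x := by
    simp [Torus.timeDerivWithin, Torus.divergence, Torus.partialDeriv, Torus.lineDeriv]
  rotEnergy t _ x := by
    simp [Torus.timeDerivWithin, Torus.divergence, Torus.partialDeriv, Torus.lineDeriv]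

end Literature.MathematicalPhysics.KineticTheory

end
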